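import Literature.NumberTheory.Automorphic.GLOneOfHeckeCharacterBJ
import Literature.NumberTheory.Automorphic.ArchParameterTwistNorm
import Literature.NumberTheory.Automorphic.AutomorphicRepsGLOneArchParameter
import Literature.NumberTheory.Automorphic.ArchParameterUnique
import Literature.NumberTheory.Automorphic.GLOneArchParameterClauses
import Literature.NumberTheory.Automorphic.AutomorphicRepsGLOneHeckeCharacter

/-!
# `RegularAdjointLiftCM` — negative lane IV: the real shift in the Hermitian symmetry of archimedean
# parameters is load-bearing (`c = 0` is false for the tree's cuspidal data)

Refuter-side support for the crux `RegularAdjointLiftCM` (item stmt-Langlands-13617, route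
`route-Langlands-IrreducibilityBySelfDuality`), cycle 3 of the standing disprover
(`Cruxes/RegularAdjointLiftCM/Disproof.lean` §12), concerning the last open stub
`stub_hermitianSymmetry` of the picked line `nu-cubed-central-character`: "for every cuspidal
Borel–Jacquet datum `π` on `GL_n(𝔸_K)` with archimedean parameter `χ` there is ONE real `c` with
`χ(ῑ) = {-ā + c : a ∈ χ(ι)}` at every embedding `ι`" (Clozel's purity lemma on multisets in its
weight-free form = unitarity of `π_∞ ⊗ |det|^{c/2}`).  No statement of the route is proved or refuted.

* `hermitianSymmetry_shift_pinned` — the shift is decided at ONE embedding: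
  `card χ(ι) · c = Σ χ(ῑ) + conj Σ χ(ι)` (for a regular algebraic `GL₃` type, `c =` Clozel's weight).
* `card_eq_of_hasArchParameter` — an archimedean parameter on `GL_n` has `n` entries everywhere
  (import-light re-proof of the tree lemma of the same name in `KimExteriorSquareGL4ArchimedeanTwist`).
* `not_hermitianSymmetry_zero` — **the strengthening `c = 0` ("the parameter itself is
  Hermitian-symmetric", true for UNITARY `π_∞`) is FALSE for the tree's cuspidal data**, unconditionally:
  on `GL₁/ℚ` the line of the trivial Hecke character is a cuspidal datum with some parameter `χ₀`
  (`exists_hasArchParameter_glOne`), its twist by `‖det‖_𝔸` is again a cuspidal datum with parameter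
  `χ₀ + 1` (`HasArchParameter.of_map_mulChar_detTwist`), and `c = 0` for both forces
  `2 · card χ₀(ι) = 0` against `card χ₀(ι) = 1`.  Moral: the Borel–Jacquet cusp forms of the tree carry
  no `A_G`-normalisation (cf. `AutomorphicRepsGLLogDetCounterexample`), so the unitarising twist `s` and
  the shift `c = -2s` are genuine data of any proof of the stub; nothing weaker than "one real `c` for
  all `ι`" can be asked.
* `hermitianSymmetry_glOne`, `hermitianSymmetry_cuspidal_glOne` — **the `n = 1` case of the stub is
  TRUE for EVERY Borel–Jacquet datum on `GL₁(𝔸_K)`** (junk data such as the tree's `π_log` included):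
  `χ(ῑ) = {-ā + 2σ : a ∈ χ(ι)}` with `|θ_π| = ‖·‖^σ` for the Hecke character `θ_π` of `π`.  The Lie
  algebra acts on the line `W/W'` through a real linear form `d` with `θ_π(det(exp Y,1)) = e^{d(Y)}`
  and `|θ_π(det(exp Y,1))| = ‖det(exp Y,1)‖_𝔸^σ = e^{σλ(Y)}`, so `Re d = σλ`; the parameter is `{d(1_w)}`
  at a real place and `{½(d(1_w) ∓ i d(i_w))}` at `σ_w, σ̄_w`, and `Re d(1_w) = σ[K_w:ℝ]`, `Re d(i_w) = 0`
  finish.  So no `n = 1` kill of the stub exists, and the unitarity mechanism (`|θ| = ‖·‖^σ` is the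
  `GL(1)` shadow of "cuspidal ⇒ unitary up to `|det|^s`") is kernel-checked in the smallest case.
* `archParameter_glOne_re_sum_eq` — corollary: `Re(Σχ(ι) + Σχ(ῑ))` is independent of `ι` (parallel
  modulus exponent, unit-free) — the uniformity the sibling cruxes `RegularTwistCM` /
  `HalfIntegralTwistCM` need for their twisting exponent.
-/

-- Mathlib idiom (Mathlib/Algebra/Lie/OfAssociative.lean): commutator brackets, to mention `𝔤 →ₗ⁅ℝ⁆ End V`
attribute [local instance 100] LieRing.ofAssociativeRing

open scoped BigOperators Topology Classical ComplexConjugate Matrix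
open Filter Set Function IsDedekindDomain NumberField NumberField.InfinitePlace NumberField.mixedEmbedding
open Literature.NumberTheory.Automorphic
open Literature.NumberTheory.GaloisRepresentations (HeckeCharacter)

set_option linter.dupNamespace false -- project-wide option (lakefile weak.linter.dupNamespace); `Summit.Langlands.Langlands` is the mandated namespace

noncomputable section

namespace Summit.Langlands.Langlands.Theorems.RegularAdjointLiftCM.Negative

/-! ### Multiset bookkeeping -/

/-- Sum of a multiset after `a ↦ -ā + c`. [folklore] -/
theorem sum_map_neg_conj_add (s : Multiset ℂ) (c : ℂ) :
    (s.map fun a => -(starRingEnd ℂ a) + c).sum = -(starRingEnd ℂ s.sum) + Multiset.card s * c := by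
  induction s using Multiset.induction_on with
  | empty => simp
  | cons a s ih =>
      rw [Multiset.map_cons, Multiset.sum_cons, Multiset.sum_cons, ih, Multiset.card_cons, map_add]
      push_cast
      ring

/-- Sum of a multiset after `a ↦ a + c`. [folklore] -/
theorem sum_map_add_const (s : Multiset ℂ) (c : ℂ) :
    (s.map fun a => a + c).sum = s.sum + Multiset.card s * c := by
  induction s using Multiset.induction_on with
  | empty => simp
  | cons a s ih =>
      rw [Multiset.map_cons, Multiset.sum_cons, Multiset.sum_cons, ih, Multiset.card_cons]
      push_cast
      ring

/-- Sum of a multiset after `a ↦ -ā`. [folklore] -/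
theorem sum_map_neg_conj (s : Multiset ℂ) :
    (s.map fun a => -(starRingEnd ℂ a)).sum = -(starRingEnd ℂ s.sum) := by
  have h := sum_map_neg_conj_add s 0
  simp only [add_zero, mul_zero] at h
  exact h

/-- Sum of a multiset after `a ↦ -conj(a + c)`. [folklore] -/
theorem sum_map_neg_conj_add_const (s : Multiset ℂ) (c : ℂ) :
    (s.map fun a => -(starRingEnd ℂ (a + c))).sum =
      -(starRingEnd ℂ s.sum) - Multiset.card s * starRingEnd ℂ c := by
  induction s using Multiset.induction_on with
  | empty => simp
  | cons a s ih =>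
      rw [Multiset.map_cons, Multiset.sum_cons, Multiset.sum_cons, ih, Multiset.card_cons, map_add,
        map_add]
      push_cast
      ring

/-- **The shift `c` is pinned by `χ` at any single embedding**: `card(χ ι) · c = Σ χ(ῑ) + conj Σ χ(ι)`
whenever `χ(ῑ) = {-ā + c : a ∈ χ(ι)}` (Clozel 1990, Lemme 4.9: `c` is the weight `w`).
[cite: Clozel1990, Lemme 4.9] -/
theorem hermitianSymmetry_shift_pinned {K : Type} [Field K] (χ : (K →+* ℂ) → Multiset ℂ) (c : ℝ)
    (ι : K →+* ℂ)
    (h : χ (ComplexEmbedding.conjugate ι) = (χ ι).map fun a => -(starRingEnd ℂ a) + (c : ℂ)) :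
    (Multiset.card (χ ι) : ℂ) * c =
      (χ (ComplexEmbedding.conjugate ι)).sum + starRingEnd ℂ (χ ι).sum := by
  rw [h, sum_map_neg_conj_add]
  ring

/-! ### The archimedean parameter has `n` entries -/

variable {K : Type} [Field K] [NumberField K] {n : ℕ} {hcpt : isCompact_glFiniteIntegralLevel n K}

/-- An archimedean parameter of a datum on `GL_n(𝔸_K)` has `n` entries at every complex embedding
(`σ` is `w.embedding` for the real place `w = mk σ`, or one of `w.embedding`, `conj ∘ w.embedding`
for the complex place; Harish-Chandra parameters of `𝔤𝔩_n(K_w)`-modules have `n` entries).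
[cite: Clozel1990, §3.3] -/
theorem card_eq_of_hasArchParameter {π : AutomorphicRepData (AutomorphyDatum.gl n K hcpt)}
    {χ : (K →+* ℂ) → Multiset ℂ} (h : π.HasArchParameter χ) (σ : K →+* ℂ) :
    Multiset.card (χ σ) = n := by
  obtain ⟨ρ, -, hre, hco⟩ := h
  rcases (InfinitePlace.mk σ).isReal_or_isComplex with hw | hw
  · have h1 := (hre ⟨InfinitePlace.mk σ, hw⟩).1 (Algebra.ofId ℝ ℂ)
    dsimp only at h1
    rwa [InfinitePlace.embedding_mk_eq_of_isReal (InfinitePlace.isReal_mk_iff.mp hw)] at h1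
  · rcases InfinitePlace.mk_eq_iff.mp (InfinitePlace.mk_embedding (InfinitePlace.mk σ)) with hσ | hσ
    · have h1 := (hco ⟨InfinitePlace.mk σ, hw⟩).1 (AlgHom.id ℝ ℂ)
      dsimp only at h1
      rwa [algHomId_toRingHom_comp, hσ] at h1
    · have h1 := (hco ⟨InfinitePlace.mk σ, hw⟩).1 (Complex.conjAe : ℂ →ₐ[ℝ] ℂ)
      dsimp only at h1
      rwa [conjAe_toRingHom_comp, hσ] at h1

/-! ### `c = 0` is false -/

/-- **Cuspidal `GL(1)` data exist over every number field**: the line `ℂ · (θ ∘ det)` over `⊥` of a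
Hecke character `θ` (on `GL(1)` every automorphic form is a cusp form, the parabolic condition being
empty).  Borel–Jacquet 1979, 4.6. [cite: BorelJacquetCorvallis1979, §4.6] -/
theorem exists_cuspidal_glOne_of_heckeCharacter (h1 : isCompact_glFiniteIntegralLevel 1 K)
    (θ : HeckeCharacter K) :
    ∃ τ : CuspidalAutomorphicRepData 1 K h1,
      τ.1.W = Submodule.span ℂ {fun g : (AdelicGroupData.gl 1 K).Adelic => (detTwist 1 θ g : ℂ)} ∧
        τ.1.W' = ⊥ := by
  obtain ⟨τ, hW, hW'⟩ := exists_automorphicRepData_detTwist_glOne h1 θ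
  have hcusp : τ.W ≤ cuspFormsGL 1 K h1 := by
    rw [hW, Submodule.span_le]
    rintro _ rfl
    exact IsCuspFormGL.mem_cuspFormsGL
      ⟨isAutomorphicForm_detTwist_glOne h1 θ, fun k hk hk1 => absurd hk1 (by omega)⟩
  exact ⟨⟨τ, hcusp⟩, hW, hW'⟩


/-- **The real shift is load-bearing: "every cuspidal datum has a Hermitian-symmetric archimedean
parameter" (shift `c = 0`) is FALSE for the Borel–Jacquet cuspidal data of the tree**, already at
`n = 1` over `ℚ`: the cuspidal `GL(1)` line of the trivial Hecke character has a parameter `χ₀`, its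
twist by `‖det‖_𝔸` has parameter `χ₀ + 1` (Borel–Jacquet 1979, 5.7), and `c = 0` for both gives
`Σχ₀(ῑ) = -conj Σχ₀(ι)` and `Σχ₀(ῑ) + 1 = -conj Σχ₀(ι) - 1`.  (Unitary `π_∞` do satisfy it:
Knapp–Vogan 1995, Ch. IX §1; the tree's cusp forms are not `A_G`-normalised.)
[cite: BorelJacquetCorvallis1979, 5.7] [cite: KnappVogan1995, Ch. IX §1 (p. 597)] -/
theorem not_hermitianSymmetry_zero :
    ¬ (∀ (n : ℕ) [NeZero n] (K : Type) [Field K] [NumberField K]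
        (hcpt : isCompact_glFiniteIntegralLevel n K) (π : CuspidalAutomorphicRepData n K hcpt)
        (χ : (K →+* ℂ) → Multiset ℂ), π.1.HasArchParameter χ →
          ∀ ι : K →+* ℂ, χ (ComplexEmbedding.conjugate ι) = (χ ι).map fun a => -(starRingEnd ℂ a)) := by
  intro h
  haveI : NeZero (1 : ℕ) := ⟨one_ne_zero⟩
  have hcpt₁ : isCompact_glFiniteIntegralLevel 1 ℚ := isCompact_glFiniteIntegralLevel_holds 1 ℚ
  obtain ⟨τ, -, -⟩ := exists_cuspidal_glOne_of_heckeCharacter hcpt₁ (1 : HeckeCharacter ℚ)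
  obtain ⟨χ₀, hχ₀⟩ := τ.1.exists_hasArchParameter_glOne
  obtain ⟨μ, hμ⟩ := exists_heckeCharacter_ideleNorm_cpow (K := ℚ) ((1 : ℝ) : ℂ)
  obtain ⟨τ', hW, hW'⟩ := exists_cuspidalAutomorphicRepData_map_mulChar_detTwist hμ τ
  have hχ₁ : τ'.1.HasArchParameter fun σ => (χ₀ σ).map (· + ((1 : ℝ) : ℂ)) :=
    AutomorphicRepData.HasArchParameter.of_map_mulChar_detTwist hμ hW hW' hχ₀
  set ι : ℚ →+* ℂ := (Classical.arbitrary (InfinitePlace ℚ)).embedding with hι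
  have hcard : Multiset.card (χ₀ ι) = 1 := card_eq_of_hasArchParameter hχ₀ ι
  have e₀ := congrArg Multiset.sum (h 1 ℚ hcpt₁ τ χ₀ hχ₀ ι)
  have c₀ := congrArg Multiset.card (h 1 ℚ hcpt₁ τ χ₀ hχ₀ ι)
  have e₁ := congrArg Multiset.sum (h 1 ℚ hcpt₁ τ' _ hχ₁ ι)
  simp only [Multiset.map_map, Function.comp_def, Multiset.card_map] at e₀ e₁ c₀
  rw [sum_map_neg_conj] at e₀
  rw [sum_map_add_const, sum_map_neg_conj_add_const, c₀, hcard] at e₁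
  simp only [Nat.cast_one, one_mul, Complex.ofReal_one, map_one] at e₁
  have : (2 : ℂ) = 0 := by linear_combination e₁ - e₀
  norm_num at this

/-! ### The `GL(1)` case holds for every datum -/

section GLOne

variable {hcpt₁ : isCompact_glFiniteIntegralLevel 1 K}

/-- The algebra behind the complex places: if `Re P = 2σ`, `Re Q = 0` then
`(P + iQ)/2 = -conj((P - iQ)/2) + 2σ`. [folklore] -/
theorem half_add_I_mul_eq {P Q : ℂ} {σ : ℝ} (hP : P.re = 2 * σ) (hQ : Q.re = 0) :
    (2 : ℂ)⁻¹ * (P + Complex.I * Q) =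
      -(conj ((2 : ℂ)⁻¹ * (P + -Complex.I * Q))) + ((2 * σ : ℝ) : ℂ) := by
  apply Complex.ext
  · simp [Complex.mul_re, Complex.mul_im, hQ]
    linarith [hP]
  · simp [Complex.mul_re, Complex.mul_im, hQ]

/-- Same with the roles of the two embeddings exchanged. [folklore] -/
theorem half_sub_I_mul_eq {P Q : ℂ} {σ : ℝ} (hP : P.re = 2 * σ) (hQ : Q.re = 0) :
    (2 : ℂ)⁻¹ * (P + -Complex.I * Q) =
      -(conj ((2 : ℂ)⁻¹ * (P + Complex.I * Q))) + ((2 * σ : ℝ) : ℂ) := by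
  apply Complex.ext
  · simp [Complex.mul_re, Complex.mul_im, hQ]
    linarith [hP]
  · simp [Complex.mul_re, Complex.mul_im, hQ]

/-- The algebra behind the real places: `Re R = σ ⇒ R = -R̄ + 2σ`. [folklore] -/
theorem eq_neg_conj_add_of_re_eq {R : ℂ} {σ : ℝ} (hR : R.re = σ) :
    R = -(conj R) + ((2 * σ : ℝ) : ℂ) := by
  apply Complex.ext
  · simp; linarith [hR]
  · simp

/-- **Hermitian symmetry of the archimedean parameter of EVERY automorphic datum on `GL₁(𝔸_K)`**:
if `π = W / W'` has archimedean parameter `χ`, then `χ(ῑ) = {-ā + 2σ : a ∈ χ(ι)}` at every embedding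
`ι`, where `|θ_π| = ‖·‖^σ` for the Hecke character `θ_π` of `π`.  Proof: `𝔤𝔩₁(K_∞)` acts on the line
`W/W'` through a real linear form `d` with `θ_π(det(exp Y, 1)) = e^{d(Y)}`
(`heckeCharacter_glOne_det_ofArch_expMem`) and `|θ_π(det(exp Y,1))| = ‖det(exp Y,1)‖^σ = e^{σ λ(Y)}`
(`exists_norm_apply_eq_ideleNorm_rpow`, `ideleNorm_det_ofInfinite_expGL_eq`), so `Re d = σ λ`; the
parameter is `{d(1_w)}` at a real place and `{½(d(1_w) ∓ i d(i_w))}` at `σ_w, σ̄_w`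
(`archParameter_clauses_glOne`), and `Re d(1_w) = σ [K_w:ℝ]`, `Re d(i_w) = 0` finish.
[cite: Clozel1990, Lemme 4.9] [cite: KnappVogan1995, Ch. IX §1 (p. 597)] -/
theorem hermitianSymmetry_glOne (π : AutomorphicRepData (AutomorphyDatum.gl 1 K hcpt₁))
    {χ : (K →+* ℂ) → Multiset ℂ} (hχ : π.HasArchParameter χ) :
    ∃ c : ℝ, ∀ ι : K →+* ℂ,
      χ (ComplexEmbedding.conjugate ι) = (χ ι).map fun a => -(starRingEnd ℂ a) + (c : ℂ) := by
  obtain ⟨θ, hθ⟩ := π.exists_heckeCharacter_glOne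
  obtain ⟨σ, hσ⟩ := θ.exists_norm_apply_eq_ideleNorm_rpow
  obtain ⟨ρ, hρ⟩ := π.exists_hasLieAction_gl
  obtain ⟨d, hd⟩ := π.exists_linearMap_lieAction_eq_smul_one_glOne ρ
  obtain ⟨hre, hco⟩ := π.archParameter_clauses_glOne hρ d hd hχ
  -- the link `θ(det (exp Y, 1)) = e^{d(Y)}`
  have hlink : ∀ Y : Matrix (Fin 1) (Fin 1) (mixedSpace K),
      ((θ (Matrix.GeneralLinearGroup.det (GLn.ofInfinite 1 K (expGL Y))) : ℂˣ) : ℂ) =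
        Complex.exp (d ⟨Y, trivial⟩) := by
    intro Y
    have h := π.heckeCharacter_glOne_det_ofArch_expMem hθ ⟨Y, trivial⟩
      (fun φ hφ => π.lieDeriv_sub_smul_mem_of_hasLieAction_glOne hρ hd ⟨Y, trivial⟩ hφ) 1
    rw [one_smul, Complex.ofReal_one, one_mul] at h
    exact h
  -- `Re d = σ λ`
  have hRe : ∀ Y : Matrix (Fin 1) (Fin 1) (mixedSpace K),
      (d ⟨Y, trivial⟩).re = σ * ((∑ w, Y.trace.1 w) + ∑ w, 2 * (Y.trace.2 w).re) := by
    intro Y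
    have h1 := hσ (Matrix.GeneralLinearGroup.det (GLn.ofInfinite 1 K (expGL Y)))
    rw [hlink, Complex.norm_exp, ideleNorm_det_ofInfinite_expGL_eq, ← Real.exp_mul] at h1
    have h2 := Real.exp_injective h1
    rw [h2]
    ring
  refine ⟨2 * σ, fun ι => ?_⟩
  rcases (mk ι).isReal_or_isComplex with hw | hw
  · -- real place
    have hι : ComplexEmbedding.IsReal ι := isReal_mk_iff.mp hw
    have e := hre ⟨mk ι, hw⟩
    dsimp only at e
    rw [embedding_mk_eq_of_isReal hι] at e
    rw [ComplexEmbedding.isReal_iff.mp hι, e, Multiset.map_singleton]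
    congr 1
    have hR := hRe (realPlaceLie 1 ⟨mk ι, hw⟩ 1)
    rw [normExponent_realPlaceLie, Matrix.trace_one, Fintype.card_fin, Nat.cast_one, mul_one] at hR
    exact eq_neg_conj_add_of_re_eq hR
  · -- complex place
    obtain ⟨w, hw'⟩ : ∃ w : {w : InfinitePlace K // w.IsComplex}, w.1 = mk ι := ⟨⟨mk ι, hw⟩, rfl⟩
    have hcard : (Fintype.card (ℂ →ₐ[ℝ] ℂ) : ℂ) = 2 := by
      rw [HCEmb.card_algHom_of_im_I (𝕜 := ℂ) (by simp)]
      norm_num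
    have hIid : conj ((AlgHom.id ℝ ℂ) (RCLike.I : ℂ)) = -Complex.I := by simp
    have hIcj : conj ((Complex.conjAe : ℂ →ₐ[ℝ] ℂ) (RCLike.I : ℂ)) = Complex.I := by simp
    -- the two values `p = ½(P - iQ)` at `σ_w` and `q = ½(P + iQ)` at `σ̄_w`
    have eid := hco w (AlgHom.id ℝ ℂ)
    have ecj := hco w (Complex.conjAe : ℂ →ₐ[ℝ] ℂ)
    rw [algHomId_toRingHom_comp] at eid
    rw [conjAe_toRingHom_comp] at ecj
    rw [HCEmb.proj_def, hcard, hIid] at eid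
    rw [HCEmb.proj_def, hcard, hIcj] at ecj
    set P : ℂ := d ⟨complexPlaceLie 1 w ((1 : ℂ) • (1 : Matrix (Fin 1) (Fin 1) ℂ)), trivial⟩ with hPdef
    set Q : ℂ := d ⟨complexPlaceLie 1 w ((((RCLike.I : ℂ)) • (1 : ℂ)) • (1 : Matrix (Fin 1) (Fin 1) ℂ)),
      trivial⟩ with hQdef
    -- `Re P = 2σ`, `Re Q = 0`
    have hP : P.re = 2 * σ := by
      have h : P.re = σ * ((∑ w', (complexPlaceLie 1 w ((1 : ℂ) • (1 : Matrix (Fin 1) (Fin 1) ℂ))).trace.1 w') +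
          ∑ w', 2 * ((complexPlaceLie 1 w ((1 : ℂ) • (1 : Matrix (Fin 1) (Fin 1) ℂ))).trace.2 w').re) :=
        hRe _
      rw [normExponent_complexPlaceLie] at h
      have t1 : (Matrix.trace ((1 : ℂ) • (1 : Matrix (Fin 1) (Fin 1) ℂ))).re = 1 := by simp
      rw [t1] at h
      rw [h]
      ring
    have hQ : Q.re = 0 := by
      have h : Q.re = σ * ((∑ w', (complexPlaceLie 1 w
            ((((RCLike.I : ℂ)) • (1 : ℂ)) • (1 : Matrix (Fin 1) (Fin 1) ℂ))).trace.1 w') +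
          ∑ w', 2 * ((complexPlaceLie 1 w
            ((((RCLike.I : ℂ)) • (1 : ℂ)) • (1 : Matrix (Fin 1) (Fin 1) ℂ))).trace.2 w').re) :=
        hRe _
      rw [normExponent_complexPlaceLie] at h
      have tI : (Matrix.trace ((((RCLike.I : ℂ)) • (1 : ℂ)) • (1 : Matrix (Fin 1) (Fin 1) ℂ))).re = 0 := by
        simp
      rw [tI] at h
      rw [h]
      ring
    have hwι : mk w.1.embedding = mk ι := (mk_embedding w.1).trans hw'
    rcases mk_eq_iff.mp hwι with h1 | h1
    · -- `ι = σ_w`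
      subst h1
      rw [ecj, eid, Multiset.map_singleton]
      congr 1
      simp only [smul_eq_mul]
      exact half_add_I_mul_eq hP hQ
    · -- `ι = σ̄_w`
      subst h1
      have hcc : ComplexEmbedding.conjugate (ComplexEmbedding.conjugate w.1.embedding) = w.1.embedding :=
        star_star _
      rw [hcc, eid, ecj, Multiset.map_singleton]
      congr 1
      simp only [smul_eq_mul]
      exact half_sub_I_mul_eq hP hQ


/-- **Corollary (parallel modulus exponent, unit-free)**: for every Borel–Jacquet datum on `GL₁(𝔸_K)`
with archimedean parameter `χ`, `Re(Σχ(ι) + Σχ(ῑ))` is the SAME real number `c` at every embedding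
(`= 2σ`, `|θ_π| = ‖·‖^σ`; at a real `ι` this reads `2 Re a_ι = c`).  This is the archimedean shadow of
"the modulus of an idele class character is a power of the norm" — the uniformity-in-`w` that the
sibling cruxes `RegularTwistCM` / `HalfIntegralTwistCM` need for their exponent `N`, obtained here
without Dirichlet's unit theorem. [cite: WeilBNT1967, Ch. IV §4, Thm. 6] -/
theorem archParameter_glOne_re_sum_eq (π : AutomorphicRepData (AutomorphyDatum.gl 1 K hcpt₁))
    {χ : (K →+* ℂ) → Multiset ℂ} (hχ : π.HasArchParameter χ) :
    ∃ c : ℝ, ∀ ι : K →+* ℂ, ((χ ι).sum + (χ (ComplexEmbedding.conjugate ι)).sum).re = c := by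
  obtain ⟨c, hc⟩ := hermitianSymmetry_glOne π hχ
  refine ⟨c, fun ι => ?_⟩
  rw [hc ι, sum_map_neg_conj_add, card_eq_of_hasArchParameter hχ ι]
  simp

/-- **The `GL(1)` case of `stub_hermitianSymmetry`, for EVERY cuspidal datum** (junk included: the
tree's `π_log = span{log‖·‖, 1}/ℂ·1` as much as Hecke-character lines). [cite: Clozel1990, Lemme 4.9] -/
theorem hermitianSymmetry_cuspidal_glOne (π : CuspidalAutomorphicRepData 1 K hcpt₁)
    {χ : (K →+* ℂ) → Multiset ℂ} (hχ : π.1.HasArchParameter χ) :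
    ∃ c : ℝ, ∀ ι : K →+* ℂ,
      χ (ComplexEmbedding.conjugate ι) = (χ ι).map fun a => -(starRingEnd ℂ a) + (c : ℂ) :=
  hermitianSymmetry_glOne π.1 hχ

end GLOne

end Summit.Langlands.Langlands.Theorems.RegularAdjointLiftCM.Negative

end
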